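import Mathlib
import HarnessLib
import Summits.HubbardSuperconductivity.HubbardSuperconductivity.Theorems.KLProgrammeC4aJetComparisonSharp
import Summits.HubbardSuperconductivity.HubbardSuperconductivity.Theorems.KLProgrammeC4aPartnerBandTangencyDefectAllPh

/-!
# Route `KLProgramme` — crux C4a, S3 brick (B2, TANGENCY, ORDERS ≤ 4, SHARP ROWS): the reductions of the pp / ph partner-band jets at order
# `k ≤ 4` using radial rows only up to order `k`

Cell `gate-hubbard-kl`, seat hubbard-kl-k3c3-p3 (g23; row «implicit-function / monotonicity route»).  Located brick «(B2)-TAN-ALL», sharp sequel of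
`…C4aPartnerBandTangencyDefectAll(Ph)` for the (C)-closer lane hubbard-kl-c4a-1 (stub (C) `stub_twoLeg_curvature` of `KLRegimeEngineV17F2`,
stmt-HubbardSuperconductivity-20437; memo HOME/hubbard-kl-c4a-1/C4A-PLAN.md §24.8, §24.9).  Same objects and binder shape (`…C4aPathJetsSix`); the
reductions are redone with `abs_iteratedDeriv_comp_add_smul_sub_le_sharp`, so that at order `k` only the radial rows `RRᵢ`, `i ≤ k`, enter
(rows `0…3` are in the tree ⇒ orders `k ≤ 3` are unconditional, see `…C4aPartnerBandTangencyDefectThree`; order `4` needs `RR₄` alone).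

With `T_k(ρ,ϑ,e) := ∂ᵏ_t|₀ e_K(S_{ρϑθ}(t) − Φ(e, φ+θ+t))`, `T^ph_k(ρ,ϑ,e) := ∂ᵏ_t|₀ e_K(Φ(e, φ+θ+t) − D_{ρϑθ}(t))`, a base `D ≥ 0` and a ratio `R ≥ 0`:
* **`abs_iteratedDeriv_partnerBand_pp/ph_sub_level_le_sharp`** — `|T_k(ρ,ϑ,e) − T_k(ρ,ϑ,0)| ≤ |e|·(k+1)!·𝒦·R·Dᵏ` whenever
  `3·msD6 j + |e|·RRⱼ ≤ Dʲ` (`1 ≤ j ≤ k`) and `RRⱼ ≤ R·Dʲ` (`j ≤ k`);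
* **`abs_iteratedDeriv_partnerBand_pp/ph_sub_config_le_sharp`** — `|T_k(ρ,ϑ,0) − T_k(ρ_T,ϑ_T,0)| ≤ (|ρ|+|ϑ−ϑ_T|)·(k+1)!·𝒦·R·Dᵏ` whenever
  `3·msD6 j + (|ρ|+|ϑ−ϑ_T|)·(RRⱼ + msD6 (j+1)) ≤ Dʲ` (`1 ≤ j ≤ k`) and `RRⱼ + msD6 (j+1) ≤ R·Dʲ` (`j ≤ k`);
* **`abs_iteratedDeriv_partnerBand_pp/ph_tangency_le_sharp`** — core + the two reductions, every `k ≤ 4`.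

Proved bookkeeping on landed objects; nothing about the Hubbard model's sizes; nothing asserts superconductivity.
References: FST II CPAM 51 (1998) §3; BGM 2006 §2.4 Lemma 2.1 (2.40) [cite: BenfattoGiulianiMastropietro2006].
-/

noncomputable section

namespace Summit.HubbardSuperconductivity.HubbardSuperconductivity.Theorems.C4a

set_option linter.dupNamespace false -- summit = problem name (single-conjunct summit), D-0017

open Real Set Filter
open scoped Topology
open Literature.MathematicalPhysics.QuantumLattice Literature.MathematicalPhysics.QuantumLattice.BandSectorCounting Literature.Probability.LatticeModels
open Summit.HubbardSuperconductivity.HubbardSuperconductivity.Theorems.KLRegimeSplit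
open Summit.HubbardSuperconductivity.HubbardSuperconductivity.Theorems.DispersionFlow
open Summit.HubbardSuperconductivity.HubbardSuperconductivity.Theorems.PerturbedFermiCurve

section Sizes

variable {K : TrigPolyC4v} {A : ℝ} (hA : ∀ p : Momentum, ∀ j ≤ 2, ‖iteratedFDeriv ℝ j (frameShift K) p‖ ≤ A) (hA20 : A ≤ 1 / 20)
  (hd : klCurveD ≤ (bandBounds (show (-4 : ℝ) < -1.1 by norm_num) (show (-1.1 : ℝ) ≤ -0.1 by norm_num)
    (show (-0.1 : ℝ) < 0 by norm_num)).Dtmin - 2 * A)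
  {μ r : ℝ} (hr : 0 < r) (hlo : (-1.1 : ℝ) < μ - r - A) (hhi : μ + r + A < -0.1)
  {A₃ A₄ A₅ A₆ : ℝ} (hA₃ : ∀ p : Momentum, ‖iteratedFDeriv ℝ 3 (frameShift K) p‖ ≤ A₃)
  (hA₄ : ∀ p : Momentum, ‖iteratedFDeriv ℝ 4 (frameShift K) p‖ ≤ A₄)
  (hA₅ : ∀ p : Momentum, ‖iteratedFDeriv ℝ 5 (frameShift K) p‖ ≤ A₅)
  (hA₆ : ∀ p : Momentum, ‖iteratedFDeriv ℝ 6 (frameShift K) p‖ ≤ A₆)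
include hA hA20 hd hr hlo hhi hA₃ hA₄ hA₅ hA₆

/-! ## §1 pp -/

/-- **SHARP REDUCTION `e → 0` AT ORDER `k ≤ 4` (pp)**: rows `RRⱼ`, `j ≤ k` only. -/
theorem abs_iteratedDeriv_partnerBand_pp_sub_level_le_sharp {k : ℕ} (hk : k ≤ 4) {𝒦 : ℝ}
    (hK : ∀ i, 1 ≤ i → i ≤ k + 1 → ∀ p : Momentum, ‖iteratedFDeriv ℝ i (frameLevel μ K) p‖ ≤ 𝒦)
    {ρ : ℝ} (hρ : |ρ| < r) {e : ℝ} (he : |e| < r) {RR : ℕ → ℝ}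
    (hRR : ∀ i, i ≤ k → ∀ s, ‖iteratedDeriv i (levelPoint μ K e) s - iteratedDeriv i (levelPoint μ K 0) s‖ ≤ RR i * |e|)
    {D R : ℝ} (hD0 : 0 ≤ D) (hR0 : 0 ≤ R) (hDrow : ∀ j, 1 ≤ j → j ≤ k → 3 * msD6 A₃ A₄ A₅ A₆ j + |e| * RR j ≤ D ^ j)
    (hRrow : ∀ j, j ≤ k → RR j ≤ R * D ^ j) (ϑ θ φ : ℝ) :
    |iteratedDeriv k (fun t : ℝ => frameLevel μ K (pairSumPath μ K ρ ϑ θ t - levelPoint μ K e (φ + θ + t))) 0 -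
      iteratedDeriv k (fun t : ℝ => frameLevel μ K (pairSumPath μ K ρ ϑ θ t - levelPoint μ K 0 (φ + θ + t))) 0| ≤
      |e| * ((k + 1).factorial * 𝒦 * R * D ^ k) := by
  set B₀ := bandBounds (show (-4 : ℝ) < -1.1 by norm_num) (show (-1.1 : ℝ) ≤ -0.1 by norm_num) (show (-0.1 : ℝ) < 0 by norm_num) with hB₀
  have hADt : 2 * A < B₀.Dtmin := by have := klCurveD_pos; linarith
  have h0 : |(0 : ℝ)| < r := by simpa using hr
  by_cases he0 : e = 0
  · subst he0; simp
  set X : ℝ → Momentum := fun t => pairSumPath μ K ρ ϑ θ t - levelPoint μ K 0 (φ + θ + t) with hX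
  set G : ℝ → Momentum := fun t => levelPoint μ K 0 (φ + θ + t) - levelPoint μ K e (φ + θ + t) with hG
  set Δ : ℝ → Momentum := e⁻¹ • G with hΔ
  have hXc : ContDiff ℝ (k + 1 : ℕ) X := (contDiff_pairSumPath B₀ hA hADt hr hlo hhi hρ ϑ θ).sub
    ((contDiff_levelPoint_of_sizes hA hd hlo hhi h0 (k + 1)).comp (contDiff_const.add contDiff_id))
  have hGc : ContDiff ℝ (k + 1 : ℕ) G := ((contDiff_levelPoint_of_sizes hA hd hlo hhi h0 (k + 1)).comp (contDiff_const.add contDiff_id)).sub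
    ((contDiff_levelPoint_of_sizes hA hd hlo hhi he (k + 1)).comp (contDiff_const.add contDiff_id))
  have hΔc : ContDiff ℝ (k + 1 : ℕ) Δ := hGc.const_smul e⁻¹
  have hfun : (fun t : ℝ => frameLevel μ K (pairSumPath μ K ρ ϑ θ t - levelPoint μ K e (φ + θ + t))) =
      fun t : ℝ => frameLevel μ K (X t + e • Δ t) := by
    funext t
    simp only [hX, hG, hΔ, Pi.smul_apply, smul_smul, mul_inv_cancel₀ he0, one_smul]
    congr 1; abel
  have hfun0 : (fun t : ℝ => frameLevel μ K (pairSumPath μ K ρ ϑ θ t - levelPoint μ K 0 (φ + θ + t))) =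
      fun t : ℝ => frameLevel μ K (X t) := rfl
  rw [hfun, hfun0]
  have hΔj : ∀ j, j ≤ k → ‖iteratedDeriv j Δ 0‖ ≤ RR j := fun j hj => by
    have hGj : ContDiffAt ℝ j G 0 := (hGc.of_le (by exact_mod_cast (hj.trans (Nat.le_succ k)))).contDiffAt
    rw [hΔ, iteratedDeriv_const_smul hGj, hG, iteratedDeriv_levelPoint_sub_levelPoint_shift_zero hA hd hlo hhi h0 he (φ + θ) j,
      norm_smul, norm_inv, Real.norm_eq_abs, ← norm_neg, neg_sub]
    have h := hRR j hj (φ + θ)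
    have hepos : 0 < |e| := abs_pos.2 he0
    rw [inv_mul_le_iff₀ hepos, mul_comm]
    exact h
  refine abs_iteratedDeriv_comp_add_smul_sub_le_sharp (EngineV8.contDiff_frameLevel μ K (n := (k + 1 : ℕ))) le_rfl hK hXc hΔc e hD0 hR0
    (fun j hj1 hj => le_trans ?_ (hDrow j hj1 hj)) (fun j hj => (hΔj j hj).trans (hRrow j hj))
  have hXj : ‖iteratedDeriv j X 0‖ ≤ 3 * msD6 A₃ A₄ A₅ A₆ j := by
    rw [hX, iteratedDeriv_pairSumPath_sub_levelPoint_zero hA hd hr hlo hhi hρ h0 ϑ θ φ j]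
    have h1 := norm_iteratedDeriv_levelPoint_le_six hA hA20 hd hlo hhi hA₃ hA₄ hA₅ hA₆ h0 hj1 (by omega) θ
    have h2 := norm_iteratedDeriv_levelPoint_le_six hA hA20 hd hlo hhi hA₃ hA₄ hA₅ hA₆ hρ hj1 (by omega) (ϑ + θ)
    have h3 := norm_iteratedDeriv_levelPoint_le_six hA hA20 hd hlo hhi hA₃ hA₄ hA₅ hA₆ h0 hj1 (by omega) (φ + θ)
    have := norm_sub_le (iteratedDeriv j (levelPoint μ K 0) θ + iteratedDeriv j (levelPoint μ K ρ) (ϑ + θ)) (iteratedDeriv j (levelPoint μ K 0) (φ + θ))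
    have := norm_add_le (iteratedDeriv j (levelPoint μ K 0) θ) (iteratedDeriv j (levelPoint μ K ρ) (ϑ + θ))
    linarith
  have t1 := hΔj j hj
  nlinarith [abs_nonneg e, mul_le_mul_of_nonneg_left t1 (abs_nonneg e)]

/-- **SHARP REDUCTION `(ρ, ϑ) → (0, 0)` AT ORDER `k ≤ 4` (pp, loop on the Fermi curve)**: rows `RRⱼ` and angle rows `msD6 (j+1)`, `j ≤ k` only. -/
theorem abs_iteratedDeriv_partnerBand_pp_sub_config_le_sharp {k : ℕ} (hk : k ≤ 4) {𝒦 : ℝ}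
    (hK : ∀ i, 1 ≤ i → i ≤ k + 1 → ∀ p : Momentum, ‖iteratedFDeriv ℝ i (frameLevel μ K) p‖ ≤ 𝒦)
    {ρ : ℝ} (hρ : |ρ| < r) {RR : ℕ → ℝ} (hRR0 : ∀ i, i ≤ k → 0 ≤ RR i)
    (hRR : ∀ i, i ≤ k → ∀ s, ‖iteratedDeriv i (levelPoint μ K ρ) s - iteratedDeriv i (levelPoint μ K 0) s‖ ≤ RR i * |ρ|)
    (ϑ : ℝ) {D R : ℝ} (hD0 : 0 ≤ D) (hR0 : 0 ≤ R)
    (hDrow : ∀ j, 1 ≤ j → j ≤ k → 3 * msD6 A₃ A₄ A₅ A₆ j + (|ρ| + |ϑ|) * (RR j + msD6 A₃ A₄ A₅ A₆ (j + 1)) ≤ D ^ j)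
    (hRrow : ∀ j, j ≤ k → RR j + msD6 A₃ A₄ A₅ A₆ (j + 1) ≤ R * D ^ j) (θ φ : ℝ) :
    |iteratedDeriv k (fun t : ℝ => frameLevel μ K (pairSumPath μ K ρ ϑ θ t - levelPoint μ K 0 (φ + θ + t))) 0 -
      iteratedDeriv k (fun t : ℝ => frameLevel μ K (pairSumPath μ K 0 0 θ t - levelPoint μ K 0 (φ + θ + t))) 0| ≤
      (|ρ| + |ϑ|) * ((k + 1).factorial * 𝒦 * R * D ^ k) := by
  set B₀ := bandBounds (show (-4 : ℝ) < -1.1 by norm_num) (show (-1.1 : ℝ) ≤ -0.1 by norm_num) (show (-0.1 : ℝ) < 0 by norm_num) with hB₀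
  have hADt : 2 * A < B₀.Dtmin := by have := klCurveD_pos; linarith
  have h0 : |(0 : ℝ)| < r := by simpa using hr
  set δ : ℝ := |ρ| + |ϑ| with hδ
  have hδ0 : 0 ≤ δ := add_nonneg (abs_nonneg ρ) (abs_nonneg ϑ)
  by_cases hδz : δ = 0
  · have hρ0 : ρ = 0 := abs_eq_zero.1 (by linarith [abs_nonneg ρ, abs_nonneg ϑ])
    have hϑ0 : ϑ = 0 := abs_eq_zero.1 (by linarith [abs_nonneg ρ, abs_nonneg ϑ])
    subst hρ0; subst hϑ0
    rw [hδz, sub_self, abs_zero, zero_mul]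
  have hδpos : 0 < δ := lt_of_le_of_ne hδ0 (Ne.symm hδz)
  set X : ℝ → Momentum := fun t => pairSumPath μ K 0 0 θ t - levelPoint μ K 0 (φ + θ + t) with hX
  set G : ℝ → Momentum := fun t => levelPoint μ K ρ (ϑ + θ + t) - levelPoint μ K 0 (θ + t) with hG
  set Δ : ℝ → Momentum := δ⁻¹ • G with hΔ
  have hXc : ContDiff ℝ (k + 1 : ℕ) X := (contDiff_pairSumPath B₀ hA hADt hr hlo hhi h0 0 θ).sub
    ((contDiff_levelPoint_of_sizes hA hd hlo hhi h0 (k + 1)).comp (contDiff_const.add contDiff_id))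
  have hGc : ContDiff ℝ (k + 1 : ℕ) G := ((contDiff_levelPoint_of_sizes hA hd hlo hhi hρ (k + 1)).comp (contDiff_const.add contDiff_id)).sub
    ((contDiff_levelPoint_of_sizes hA hd hlo hhi h0 (k + 1)).comp (contDiff_const.add contDiff_id))
  have hΔc : ContDiff ℝ (k + 1 : ℕ) Δ := hGc.const_smul δ⁻¹
  have hfun : (fun t : ℝ => frameLevel μ K (pairSumPath μ K ρ ϑ θ t - levelPoint μ K 0 (φ + θ + t))) =
      fun t : ℝ => frameLevel μ K (X t + δ • Δ t) := by
    funext t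
    simp only [hX, hG, hΔ, Pi.smul_apply, smul_smul, mul_inv_cancel₀ hδz, one_smul, pairSumPath, zero_add]
    congr 1; abel
  have hfun0 : (fun t : ℝ => frameLevel μ K (pairSumPath μ K 0 0 θ t - levelPoint μ K 0 (φ + θ + t))) =
      fun t : ℝ => frameLevel μ K (X t) := rfl
  rw [hfun, hfun0]
  have hGj : ∀ j, j ≤ k → ‖iteratedDeriv j G 0‖ ≤ RR j * |ρ| + msD6 A₃ A₄ A₅ A₆ (j + 1) * |ϑ| := fun j hj => by
    have h1 : ContDiff ℝ j (fun t : ℝ => levelPoint μ K ρ (ϑ + θ + t)) := (contDiff_levelPoint_of_sizes hA hd hlo hhi hρ j).comp (contDiff_const.add contDiff_id)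
    have h2 : ContDiff ℝ j (fun t : ℝ => levelPoint μ K 0 (θ + t)) := (contDiff_levelPoint_of_sizes hA hd hlo hhi h0 j).comp (contDiff_const.add contDiff_id)
    rw [hG, iteratedDeriv_fun_sub h1.contDiffAt h2.contDiffAt, iteratedDeriv_comp_const_add (f := levelPoint μ K ρ),
      iteratedDeriv_comp_const_add (f := levelPoint μ K 0)]
    simp only [add_zero]
    have e1 : iteratedDeriv j (levelPoint μ K ρ) (ϑ + θ) - iteratedDeriv j (levelPoint μ K 0) θ =
        (iteratedDeriv j (levelPoint μ K ρ) (ϑ + θ) - iteratedDeriv j (levelPoint μ K 0) (ϑ + θ)) +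
        (iteratedDeriv j (levelPoint μ K 0) (ϑ + θ) - iteratedDeriv j (levelPoint μ K 0) θ) := by abel
    rw [e1]
    refine (norm_add_le _ _).trans (add_le_add (hRR j hj (ϑ + θ)) ?_)
    have h := norm_iteratedDeriv_levelPoint_sub_le_angle_six hA hA20 hd hlo hhi hA₃ hA₄ hA₅ hA₆ h0 (by omega : j ≤ 5) (ϑ + θ) θ
    rwa [show ϑ + θ - θ = ϑ by ring] at h
  have hΔj : ∀ j, j ≤ k → ‖iteratedDeriv j Δ 0‖ ≤ RR j + msD6 A₃ A₄ A₅ A₆ (j + 1) := fun j hj => by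
    have hGjc : ContDiffAt ℝ j G 0 := (hGc.of_le (by exact_mod_cast (hj.trans (Nat.le_succ k)))).contDiffAt
    rw [hΔ, iteratedDeriv_const_smul hGjc, norm_smul, norm_inv, Real.norm_eq_abs, abs_of_pos hδpos, inv_mul_le_iff₀ hδpos]
    refine (hGj j hj).trans ?_
    have hM : 0 ≤ msD6 A₃ A₄ A₅ A₆ (j + 1) := msD6_nonneg hA hA20 hd hlo hhi hA₃ hA₄ hA₅ hA₆ (by omega) (by omega) h0
    have hR := hRR0 j hj
    rw [hδ]
    nlinarith [abs_nonneg ρ, abs_nonneg ϑ]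
  have hcmp := abs_iteratedDeriv_comp_add_smul_sub_le_sharp (EngineV8.contDiff_frameLevel μ K (n := (k + 1 : ℕ))) le_rfl hK hXc hΔc δ hD0 hR0
    (fun j hj1 hj => le_trans ?_ (hDrow j hj1 hj)) (fun j hj => (hΔj j hj).trans (hRrow j hj))
  · rwa [abs_of_nonneg hδ0] at hcmp
  have hXj : ‖iteratedDeriv j X 0‖ ≤ 3 * msD6 A₃ A₄ A₅ A₆ j := by
    rw [hX, iteratedDeriv_pairSumPath_sub_levelPoint_zero hA hd hr hlo hhi h0 h0 0 θ φ j]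
    have h1 := norm_iteratedDeriv_levelPoint_le_six hA hA20 hd hlo hhi hA₃ hA₄ hA₅ hA₆ h0 hj1 (by omega) θ
    have h2 := norm_iteratedDeriv_levelPoint_le_six hA hA20 hd hlo hhi hA₃ hA₄ hA₅ hA₆ h0 hj1 (by omega) (0 + θ)
    have h3 := norm_iteratedDeriv_levelPoint_le_six hA hA20 hd hlo hhi hA₃ hA₄ hA₅ hA₆ h0 hj1 (by omega) (φ + θ)
    have := norm_sub_le (iteratedDeriv j (levelPoint μ K 0) θ + iteratedDeriv j (levelPoint μ K 0) (0 + θ)) (iteratedDeriv j (levelPoint μ K 0) (φ + θ))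
    have := norm_add_le (iteratedDeriv j (levelPoint μ K 0) θ) (iteratedDeriv j (levelPoint μ K 0) (0 + θ))
    linarith
  have t1 := hΔj j hj
  rw [abs_of_nonneg hδ0]
  nlinarith [mul_le_mul_of_nonneg_left t1 hδ0]

/-- **SHARP ASSEMBLY (pp), `k ≤ 4`**: `|T_k(ρ,ϑ,e)| ≤ (k+2)!·𝒦·(3𝒟)^{k+2}·φ² + |e|·(k+1)!·𝒦·R₁·D₁ᵏ + (|ρ|+|ϑ|)·(k+1)!·𝒦·R₂·D₂ᵏ`, rows `RRᵢ`
(`i ≤ k`) only — UNCONDITIONAL for `k ≤ 3` once the tree rows are plugged in (`…C4aPartnerBandTangencyDefectThree`). -/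
theorem abs_iteratedDeriv_partnerBand_pp_tangency_le_sharp {k : ℕ} (hk : k ≤ 4) {𝒦 𝒟 : ℝ}
    (hK : ∀ i, 1 ≤ i → i ≤ k + 2 → ∀ p : Momentum, ‖iteratedFDeriv ℝ i (frameLevel μ K) p‖ ≤ 𝒦)
    (hD : ∀ i, 1 ≤ i → i ≤ k + 2 → msD6 A₃ A₄ A₅ A₆ i ≤ 𝒟 ^ i)
    {ρ : ℝ} (hρ : |ρ| < r) {e : ℝ} (he : |e| < r) {RR : ℕ → ℝ} (hRR0 : ∀ i, i ≤ k → 0 ≤ RR i)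
    (hRRe : ∀ i, i ≤ k → ∀ s, ‖iteratedDeriv i (levelPoint μ K e) s - iteratedDeriv i (levelPoint μ K 0) s‖ ≤ RR i * |e|)
    (hRRρ : ∀ i, i ≤ k → ∀ s, ‖iteratedDeriv i (levelPoint μ K ρ) s - iteratedDeriv i (levelPoint μ K 0) s‖ ≤ RR i * |ρ|)
    (ϑ : ℝ) {D₁ R₁ D₂ R₂ : ℝ} (hD₁0 : 0 ≤ D₁) (hR₁0 : 0 ≤ R₁) (hD₂0 : 0 ≤ D₂) (hR₂0 : 0 ≤ R₂)
    (hD₁ : ∀ j, 1 ≤ j → j ≤ k → 3 * msD6 A₃ A₄ A₅ A₆ j + |e| * RR j ≤ D₁ ^ j) (hR₁ : ∀ j, j ≤ k → RR j ≤ R₁ * D₁ ^ j)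
    (hD₂ : ∀ j, 1 ≤ j → j ≤ k → 3 * msD6 A₃ A₄ A₅ A₆ j + (|ρ| + |ϑ|) * (RR j + msD6 A₃ A₄ A₅ A₆ (j + 1)) ≤ D₂ ^ j)
    (hR₂ : ∀ j, j ≤ k → RR j + msD6 A₃ A₄ A₅ A₆ (j + 1) ≤ R₂ * D₂ ^ j) (θ φ : ℝ) :
    |iteratedDeriv k (fun t : ℝ => frameLevel μ K (pairSumPath μ K ρ ϑ θ t - levelPoint μ K e (φ + θ + t))) 0| ≤
      (k + 2).factorial * 𝒦 * (3 * 𝒟) ^ (k + 2) * φ ^ 2 + |e| * ((k + 1).factorial * 𝒦 * R₁ * D₁ ^ k) +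
        (|ρ| + |ϑ|) * ((k + 1).factorial * 𝒦 * R₂ * D₂ ^ k) := by
  have hK1 : ∀ i, 1 ≤ i → i ≤ k + 1 → ∀ p : Momentum, ‖iteratedFDeriv ℝ i (frameLevel μ K) p‖ ≤ 𝒦 := fun i hi1 hi p => hK i hi1 (by omega) p
  have step1 := abs_iteratedDeriv_partnerBand_pp_sub_level_le_sharp hA hA20 hd hr hlo hhi hA₃ hA₄ hA₅ hA₆ hk hK1 hρ he hRRe hD₁0 hR₁0 hD₁ hR₁ ϑ θ φ
  have step2 := abs_iteratedDeriv_partnerBand_pp_sub_config_le_sharp hA hA20 hd hr hlo hhi hA₃ hA₄ hA₅ hA₆ hk hK1 hρ hRR0 hRRρ ϑ hD₂0 hR₂0 hD₂ hR₂ θ φ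
  have step3 := abs_iteratedDeriv_partnerBand_pp_tangency_core_le hA hA20 hd hr hlo hhi hA₃ hA₄ hA₅ hA₆ hk hK hD θ φ
  have tri := abs_sub_abs_le_abs_sub (iteratedDeriv k (fun t : ℝ => frameLevel μ K (pairSumPath μ K ρ ϑ θ t - levelPoint μ K e (φ + θ + t))) 0)
    (iteratedDeriv k (fun t : ℝ => frameLevel μ K (pairSumPath μ K ρ ϑ θ t - levelPoint μ K 0 (φ + θ + t))) 0)
  have tri' := abs_sub_abs_le_abs_sub (iteratedDeriv k (fun t : ℝ => frameLevel μ K (pairSumPath μ K ρ ϑ θ t - levelPoint μ K 0 (φ + θ + t))) 0)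
    (iteratedDeriv k (fun t : ℝ => frameLevel μ K (pairSumPath μ K 0 0 θ t - levelPoint μ K 0 (φ + θ + t))) 0)
  linarith

/-! ## §2 ph -/

/-- **SHARP REDUCTION `e → 0` AT ORDER `k ≤ 4` (ph)**: rows `RRⱼ`, `j ≤ k` only. -/
theorem abs_iteratedDeriv_partnerBand_ph_sub_level_le_sharp {k : ℕ} (hk : k ≤ 4) {𝒦 : ℝ}
    (hK : ∀ i, 1 ≤ i → i ≤ k + 1 → ∀ p : Momentum, ‖iteratedFDeriv ℝ i (frameLevel μ K) p‖ ≤ 𝒦)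
    {ρ : ℝ} (hρ : |ρ| < r) {e : ℝ} (he : |e| < r) {RR : ℕ → ℝ}
    (hRR : ∀ i, i ≤ k → ∀ s, ‖iteratedDeriv i (levelPoint μ K e) s - iteratedDeriv i (levelPoint μ K 0) s‖ ≤ RR i * |e|)
    {D R : ℝ} (hD0 : 0 ≤ D) (hR0 : 0 ≤ R) (hDrow : ∀ j, 1 ≤ j → j ≤ k → 3 * msD6 A₃ A₄ A₅ A₆ j + |e| * RR j ≤ D ^ j)
    (hRrow : ∀ j, j ≤ k → RR j ≤ R * D ^ j) (ϑ θ φ : ℝ) :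
    |iteratedDeriv k (fun t : ℝ => frameLevel μ K (levelPoint μ K e (φ + θ + t) - pairDiffPath μ K ρ ϑ θ t)) 0 -
      iteratedDeriv k (fun t : ℝ => frameLevel μ K (levelPoint μ K 0 (φ + θ + t) - pairDiffPath μ K ρ ϑ θ t)) 0| ≤
      |e| * ((k + 1).factorial * 𝒦 * R * D ^ k) := by
  set B₀ := bandBounds (show (-4 : ℝ) < -1.1 by norm_num) (show (-1.1 : ℝ) ≤ -0.1 by norm_num) (show (-0.1 : ℝ) < 0 by norm_num) with hB₀
  have hADt : 2 * A < B₀.Dtmin := by have := klCurveD_pos; linarith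
  have h0 : |(0 : ℝ)| < r := by simpa using hr
  by_cases he0 : e = 0
  · subst he0; simp
  set X : ℝ → Momentum := fun t => levelPoint μ K 0 (φ + θ + t) - pairDiffPath μ K ρ ϑ θ t with hX
  set G : ℝ → Momentum := fun t => levelPoint μ K e (φ + θ + t) - levelPoint μ K 0 (φ + θ + t) with hG
  set Δ : ℝ → Momentum := e⁻¹ • G with hΔ
  have hXc : ContDiff ℝ (k + 1 : ℕ) X := ((contDiff_levelPoint_of_sizes hA hd hlo hhi h0 (k + 1)).comp (contDiff_const.add contDiff_id)).sub
    (contDiff_pairDiffPath B₀ hA hADt hr hlo hhi hρ ϑ θ)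
  have hGc : ContDiff ℝ (k + 1 : ℕ) G := ((contDiff_levelPoint_of_sizes hA hd hlo hhi he (k + 1)).comp (contDiff_const.add contDiff_id)).sub
    ((contDiff_levelPoint_of_sizes hA hd hlo hhi h0 (k + 1)).comp (contDiff_const.add contDiff_id))
  have hΔc : ContDiff ℝ (k + 1 : ℕ) Δ := hGc.const_smul e⁻¹
  have hfun : (fun t : ℝ => frameLevel μ K (levelPoint μ K e (φ + θ + t) - pairDiffPath μ K ρ ϑ θ t)) =
      fun t : ℝ => frameLevel μ K (X t + e • Δ t) := by
    funext t
    simp only [hX, hG, hΔ, Pi.smul_apply, smul_smul, mul_inv_cancel₀ he0, one_smul]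
    congr 1; abel
  have hfun0 : (fun t : ℝ => frameLevel μ K (levelPoint μ K 0 (φ + θ + t) - pairDiffPath μ K ρ ϑ θ t)) =
      fun t : ℝ => frameLevel μ K (X t) := rfl
  rw [hfun, hfun0]
  have hΔj : ∀ j, j ≤ k → ‖iteratedDeriv j Δ 0‖ ≤ RR j := fun j hj => by
    have hGj : ContDiffAt ℝ j G 0 := (hGc.of_le (by exact_mod_cast (hj.trans (Nat.le_succ k)))).contDiffAt
    rw [hΔ, iteratedDeriv_const_smul hGj, hG, iteratedDeriv_levelPoint_sub_levelPoint_shift_zero hA hd hlo hhi he h0 (φ + θ) j,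
      norm_smul, norm_inv, Real.norm_eq_abs]
    have h := hRR j hj (φ + θ)
    have hepos : 0 < |e| := abs_pos.2 he0
    rw [inv_mul_le_iff₀ hepos, mul_comm]
    exact h
  refine abs_iteratedDeriv_comp_add_smul_sub_le_sharp (EngineV8.contDiff_frameLevel μ K (n := (k + 1 : ℕ))) le_rfl hK hXc hΔc e hD0 hR0
    (fun j hj1 hj => le_trans ?_ (hDrow j hj1 hj)) (fun j hj => (hΔj j hj).trans (hRrow j hj))
  have hXj : ‖iteratedDeriv j X 0‖ ≤ 3 * msD6 A₃ A₄ A₅ A₆ j := by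
    rw [hX, iteratedDeriv_levelPoint_sub_pairDiffPath_zero hA hd hr hlo hhi hρ h0 ϑ θ φ j]
    have h1 := norm_iteratedDeriv_levelPoint_le_six hA hA20 hd hlo hhi hA₃ hA₄ hA₅ hA₆ h0 hj1 (by omega) θ
    have h2 := norm_iteratedDeriv_levelPoint_le_six hA hA20 hd hlo hhi hA₃ hA₄ hA₅ hA₆ hρ hj1 (by omega) (ϑ + θ)
    have h3 := norm_iteratedDeriv_levelPoint_le_six hA hA20 hd hlo hhi hA₃ hA₄ hA₅ hA₆ h0 hj1 (by omega) (φ + θ)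
    have := norm_sub_le (iteratedDeriv j (levelPoint μ K 0) (φ + θ)) (iteratedDeriv j (levelPoint μ K 0) θ - iteratedDeriv j (levelPoint μ K ρ) (ϑ + θ))
    have := norm_sub_le (iteratedDeriv j (levelPoint μ K 0) θ) (iteratedDeriv j (levelPoint μ K ρ) (ϑ + θ))
    linarith
  have t1 := hΔj j hj
  nlinarith [abs_nonneg e, mul_le_mul_of_nonneg_left t1 (abs_nonneg e)]

/-- **SHARP REDUCTION `(ρ, ϑ) → (0, π)` AT ORDER `k ≤ 4` (ph, loop on the Fermi curve)**: rows `RRⱼ` and angle rows `msD6 (j+1)`, `j ≤ k` only. -/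
theorem abs_iteratedDeriv_partnerBand_ph_sub_config_le_sharp {k : ℕ} (hk : k ≤ 4) {𝒦 : ℝ}
    (hK : ∀ i, 1 ≤ i → i ≤ k + 1 → ∀ p : Momentum, ‖iteratedFDeriv ℝ i (frameLevel μ K) p‖ ≤ 𝒦)
    {ρ : ℝ} (hρ : |ρ| < r) {RR : ℕ → ℝ} (hRR0 : ∀ i, i ≤ k → 0 ≤ RR i)
    (hRR : ∀ i, i ≤ k → ∀ s, ‖iteratedDeriv i (levelPoint μ K ρ) s - iteratedDeriv i (levelPoint μ K 0) s‖ ≤ RR i * |ρ|)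
    (ϑ : ℝ) {D R : ℝ} (hD0 : 0 ≤ D) (hR0 : 0 ≤ R)
    (hDrow : ∀ j, 1 ≤ j → j ≤ k → 3 * msD6 A₃ A₄ A₅ A₆ j + (|ρ| + |ϑ - π|) * (RR j + msD6 A₃ A₄ A₅ A₆ (j + 1)) ≤ D ^ j)
    (hRrow : ∀ j, j ≤ k → RR j + msD6 A₃ A₄ A₅ A₆ (j + 1) ≤ R * D ^ j) (θ φ : ℝ) :
    |iteratedDeriv k (fun t : ℝ => frameLevel μ K (levelPoint μ K 0 (φ + θ + t) - pairDiffPath μ K ρ ϑ θ t)) 0 -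
      iteratedDeriv k (fun t : ℝ => frameLevel μ K (levelPoint μ K 0 (φ + θ + t) - pairDiffPath μ K 0 π θ t)) 0| ≤
      (|ρ| + |ϑ - π|) * ((k + 1).factorial * 𝒦 * R * D ^ k) := by
  set B₀ := bandBounds (show (-4 : ℝ) < -1.1 by norm_num) (show (-1.1 : ℝ) ≤ -0.1 by norm_num) (show (-0.1 : ℝ) < 0 by norm_num) with hB₀
  have hADt : 2 * A < B₀.Dtmin := by have := klCurveD_pos; linarith
  have h0 : |(0 : ℝ)| < r := by simpa using hr
  set δ : ℝ := |ρ| + |ϑ - π| with hδ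
  have hδ0 : 0 ≤ δ := add_nonneg (abs_nonneg ρ) (abs_nonneg _)
  by_cases hδz : δ = 0
  · have hρ0 : ρ = 0 := abs_eq_zero.1 (by linarith [abs_nonneg ρ, abs_nonneg (ϑ - π)])
    have hϑ0 : ϑ = π := by have h := abs_eq_zero.1 (show |ϑ - π| = 0 by linarith [abs_nonneg ρ, abs_nonneg (ϑ - π)]); linarith
    subst hρ0; subst hϑ0
    rw [hδz, sub_self, abs_zero, zero_mul]
  have hδpos : 0 < δ := lt_of_le_of_ne hδ0 (Ne.symm hδz)
  set X : ℝ → Momentum := fun t => levelPoint μ K 0 (φ + θ + t) - pairDiffPath μ K 0 π θ t with hX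
  set G : ℝ → Momentum := pairSumPath μ K ρ ϑ θ with hG
  set Δ : ℝ → Momentum := δ⁻¹ • G with hΔ
  have hXc : ContDiff ℝ (k + 1 : ℕ) X := ((contDiff_levelPoint_of_sizes hA hd hlo hhi h0 (k + 1)).comp (contDiff_const.add contDiff_id)).sub
    (contDiff_pairDiffPath B₀ hA hADt hr hlo hhi h0 π θ)
  have hGc : ContDiff ℝ (k + 1 : ℕ) G := contDiff_pairSumPath B₀ hA hADt hr hlo hhi hρ ϑ θ
  have hΔc : ContDiff ℝ (k + 1 : ℕ) Δ := hGc.const_smul δ⁻¹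
  have hfun : (fun t : ℝ => frameLevel μ K (levelPoint μ K 0 (φ + θ + t) - pairDiffPath μ K ρ ϑ θ t)) =
      fun t : ℝ => frameLevel μ K (X t + δ • Δ t) := by
    funext t
    have hs := pairDiffPath_pi_sub_eq_pairSumPath μ K ρ ϑ θ t
    simp only [hX, hG, hΔ, Pi.smul_apply, smul_smul, mul_inv_cancel₀ hδz, one_smul]
    rw [← hs]
    congr 1; abel
  have hfun0 : (fun t : ℝ => frameLevel μ K (levelPoint μ K 0 (φ + θ + t) - pairDiffPath μ K 0 π θ t)) =
      fun t : ℝ => frameLevel μ K (X t) := rfl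
  rw [hfun, hfun0]
  have hGj : ∀ j, j ≤ k → ‖iteratedDeriv j G 0‖ ≤ RR j * |ρ| + msD6 A₃ A₄ A₅ A₆ (j + 1) * |ϑ - π| := fun j hj => by
    rw [hG, iteratedDeriv_pairSumPath_zero hA hd hr hlo hhi hρ ϑ θ j]
    have e1 : iteratedDeriv j (levelPoint μ K 0) θ + iteratedDeriv j (levelPoint μ K ρ) (ϑ + θ) =
        (iteratedDeriv j (levelPoint μ K ρ) (ϑ + θ) - iteratedDeriv j (levelPoint μ K 0) (ϑ + θ)) +
        (iteratedDeriv j (levelPoint μ K 0) (ϑ + θ) - iteratedDeriv j (levelPoint μ K 0) (θ + π)) := by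
      rw [iteratedDeriv_levelPoint_add_pi]; abel
    rw [e1]
    refine (norm_add_le _ _).trans (add_le_add (hRR j hj (ϑ + θ)) ?_)
    have h := norm_iteratedDeriv_levelPoint_sub_le_angle_six hA hA20 hd hlo hhi hA₃ hA₄ hA₅ hA₆ h0 (by omega : j ≤ 5) (ϑ + θ) (θ + π)
    rwa [show ϑ + θ - (θ + π) = ϑ - π by ring] at h
  have hΔj : ∀ j, j ≤ k → ‖iteratedDeriv j Δ 0‖ ≤ RR j + msD6 A₃ A₄ A₅ A₆ (j + 1) := fun j hj => by
    have hGjc : ContDiffAt ℝ j G 0 := (hGc.of_le (by exact_mod_cast (hj.trans (Nat.le_succ k)))).contDiffAt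
    rw [hΔ, iteratedDeriv_const_smul hGjc, norm_smul, norm_inv, Real.norm_eq_abs, abs_of_pos hδpos, inv_mul_le_iff₀ hδpos]
    refine (hGj j hj).trans ?_
    have hM : 0 ≤ msD6 A₃ A₄ A₅ A₆ (j + 1) := msD6_nonneg hA hA20 hd hlo hhi hA₃ hA₄ hA₅ hA₆ (by omega) (by omega) h0
    have hR := hRR0 j hj
    rw [hδ]
    nlinarith [abs_nonneg ρ, abs_nonneg (ϑ - π)]
  have hcmp := abs_iteratedDeriv_comp_add_smul_sub_le_sharp (EngineV8.contDiff_frameLevel μ K (n := (k + 1 : ℕ))) le_rfl hK hXc hΔc δ hD0 hR0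
    (fun j hj1 hj => le_trans ?_ (hDrow j hj1 hj)) (fun j hj => (hΔj j hj).trans (hRrow j hj))
  · rwa [abs_of_nonneg hδ0] at hcmp
  have hXj : ‖iteratedDeriv j X 0‖ ≤ 3 * msD6 A₃ A₄ A₅ A₆ j := by
    rw [hX, iteratedDeriv_levelPoint_sub_pairDiffPath_zero hA hd hr hlo hhi h0 h0 π θ φ j]
    have h1 := norm_iteratedDeriv_levelPoint_le_six hA hA20 hd hlo hhi hA₃ hA₄ hA₅ hA₆ h0 hj1 (by omega) θ
    have h2 := norm_iteratedDeriv_levelPoint_le_six hA hA20 hd hlo hhi hA₃ hA₄ hA₅ hA₆ h0 hj1 (by omega) (π + θ)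
    have h3 := norm_iteratedDeriv_levelPoint_le_six hA hA20 hd hlo hhi hA₃ hA₄ hA₅ hA₆ h0 hj1 (by omega) (φ + θ)
    have := norm_sub_le (iteratedDeriv j (levelPoint μ K 0) (φ + θ)) (iteratedDeriv j (levelPoint μ K 0) θ - iteratedDeriv j (levelPoint μ K 0) (π + θ))
    have := norm_sub_le (iteratedDeriv j (levelPoint μ K 0) θ) (iteratedDeriv j (levelPoint μ K 0) (π + θ))
    linarith
  have t1 := hΔj j hj
  rw [abs_of_nonneg hδ0]
  nlinarith [mul_le_mul_of_nonneg_left t1 hδ0]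

/-- **SHARP ASSEMBLY (ph), `k ≤ 4`**: `|T^ph_k(ρ,ϑ,e)| ≤ (k+2)!·𝒦·(3𝒟)^{k+2}·φ² + |e|·(k+1)!·𝒦·R₁·D₁ᵏ + (|ρ|+|ϑ−π|)·(k+1)!·𝒦·R₂·D₂ᵏ`, rows `RRᵢ`
(`i ≤ k`) only. -/
theorem abs_iteratedDeriv_partnerBand_ph_tangency_le_sharp {k : ℕ} (hk : k ≤ 4) {𝒦 𝒟 : ℝ}
    (hK : ∀ i, 1 ≤ i → i ≤ k + 2 → ∀ p : Momentum, ‖iteratedFDeriv ℝ i (frameLevel μ K) p‖ ≤ 𝒦)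
    (hD : ∀ i, 1 ≤ i → i ≤ k + 2 → msD6 A₃ A₄ A₅ A₆ i ≤ 𝒟 ^ i)
    {ρ : ℝ} (hρ : |ρ| < r) {e : ℝ} (he : |e| < r) {RR : ℕ → ℝ} (hRR0 : ∀ i, i ≤ k → 0 ≤ RR i)
    (hRRe : ∀ i, i ≤ k → ∀ s, ‖iteratedDeriv i (levelPoint μ K e) s - iteratedDeriv i (levelPoint μ K 0) s‖ ≤ RR i * |e|)
    (hRRρ : ∀ i, i ≤ k → ∀ s, ‖iteratedDeriv i (levelPoint μ K ρ) s - iteratedDeriv i (levelPoint μ K 0) s‖ ≤ RR i * |ρ|)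
    (ϑ : ℝ) {D₁ R₁ D₂ R₂ : ℝ} (hD₁0 : 0 ≤ D₁) (hR₁0 : 0 ≤ R₁) (hD₂0 : 0 ≤ D₂) (hR₂0 : 0 ≤ R₂)
    (hD₁ : ∀ j, 1 ≤ j → j ≤ k → 3 * msD6 A₃ A₄ A₅ A₆ j + |e| * RR j ≤ D₁ ^ j) (hR₁ : ∀ j, j ≤ k → RR j ≤ R₁ * D₁ ^ j)
    (hD₂ : ∀ j, 1 ≤ j → j ≤ k → 3 * msD6 A₃ A₄ A₅ A₆ j + (|ρ| + |ϑ - π|) * (RR j + msD6 A₃ A₄ A₅ A₆ (j + 1)) ≤ D₂ ^ j)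
    (hR₂ : ∀ j, j ≤ k → RR j + msD6 A₃ A₄ A₅ A₆ (j + 1) ≤ R₂ * D₂ ^ j) (θ φ : ℝ) :
    |iteratedDeriv k (fun t : ℝ => frameLevel μ K (levelPoint μ K e (φ + θ + t) - pairDiffPath μ K ρ ϑ θ t)) 0| ≤
      (k + 2).factorial * 𝒦 * (3 * 𝒟) ^ (k + 2) * φ ^ 2 + |e| * ((k + 1).factorial * 𝒦 * R₁ * D₁ ^ k) +
        (|ρ| + |ϑ - π|) * ((k + 1).factorial * 𝒦 * R₂ * D₂ ^ k) := by
  have hK1 : ∀ i, 1 ≤ i → i ≤ k + 1 → ∀ p : Momentum, ‖iteratedFDeriv ℝ i (frameLevel μ K) p‖ ≤ 𝒦 := fun i hi1 hi p => hK i hi1 (by omega) p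
  have step1 := abs_iteratedDeriv_partnerBand_ph_sub_level_le_sharp hA hA20 hd hr hlo hhi hA₃ hA₄ hA₅ hA₆ hk hK1 hρ he hRRe hD₁0 hR₁0 hD₁ hR₁ ϑ θ φ
  have step2 := abs_iteratedDeriv_partnerBand_ph_sub_config_le_sharp hA hA20 hd hr hlo hhi hA₃ hA₄ hA₅ hA₆ hk hK1 hρ hRR0 hRRρ ϑ hD₂0 hR₂0 hD₂ hR₂ θ φ
  have step3 := abs_iteratedDeriv_partnerBand_ph_tangency_core_le hA hA20 hd hr hlo hhi hA₃ hA₄ hA₅ hA₆ hk hK hD θ φ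
  have tri := abs_sub_abs_le_abs_sub (iteratedDeriv k (fun t : ℝ => frameLevel μ K (levelPoint μ K e (φ + θ + t) - pairDiffPath μ K ρ ϑ θ t)) 0)
    (iteratedDeriv k (fun t : ℝ => frameLevel μ K (levelPoint μ K 0 (φ + θ + t) - pairDiffPath μ K ρ ϑ θ t)) 0)
  have tri' := abs_sub_abs_le_abs_sub (iteratedDeriv k (fun t : ℝ => frameLevel μ K (levelPoint μ K 0 (φ + θ + t) - pairDiffPath μ K ρ ϑ θ t)) 0)
    (iteratedDeriv k (fun t : ℝ => frameLevel μ K (levelPoint μ K 0 (φ + θ + t) - pairDiffPath μ K 0 π θ t)) 0)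
  linarith

end Sizes

end Summit.HubbardSuperconductivity.HubbardSuperconductivity.Theorems.C4a

end
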